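import Mathlib.Analysis.MeanInequalities
import Mathlib.Analysis.SpecialFunctions.Pow.Real
import Literature.Barriers.ValiantsHypothesis.MonotoneGap
import HarnessLib

/-!
# The monotone gap, proofs (2): the support of `ST` and Jerrum–Snir's rectangle bound

Sibling of `Literature/Barriers/ValiantsHypothesis/MonotoneGap.lean`, second of the files proving
the named fact `JerrumSnir1982_spanningTree` stated there.

**What is proved here.**

1. `support_stPoly`, `card_support_stPoly`: the monomials of the spanning tree polynomial
   `stPoly R N` (over a nontrivial semiring) are exactly the exponent vectors
   `arbMonomial t = Σ_i e_{(i, t i)}` of the arborescences `t`, one each.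
2. `card_support_mul_le` (**Jerrum–Snir's crude content bound**, [JerrumSnir1982, §4.5]): if
   `a, b` are nonzero polynomials over `ℝ≥0` with `mon(a · b) ⊆ mon(ST)`, and `k = deg a`, then
   `|mon(a · b)| ≤ ((N + k² + (N-k)² + k(N-k)) / N)^N`. The printed argument: every monomial of
   `a` uses the same set `I` of `k` rows and every monomial of `b` the complementary rows; for
   `i ∈ I`, `j ∉ I` "the indeterminates `x_{i j}` and `x_{j i}` cannot both appear", "for if they
   did, `x_{i j}` would appear in `a`, `x_{j i}` would appear in `b`, and the invalid monomial
   `x_{i j} x_{j i} m` would appear in `mon(ab)`" (a 2-cycle is not a tree); "The number of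
   monomials in `mon(ab)` is clearly bounded by the number of functions `t` which respect
   `x_{i,t(i)} ∈ X_i`; this number is just `Π |X_i|`. The product is maximized when `|X_i|` is
   independent of `i`" (AM–GM), with `Σ_i |X_i| ≤ N + |I|² + |Iᶜ|² + |I| |Iᶜ|` here (the printed
   count is for three factors `a b c` and an `n × n` array; ours is the two-factor case consumed
   by the balanced decomposition, cf. [ChattopadhyayDattaGhosalMukhopadhyay2022, §3]).

## References

* [JerrumSnir1982] M. Jerrum, M. Snir, *Some exact complexity results for straight-line
  computations over semirings*, J. ACM 29 (1982) 874–897, §4.5 (pp. 891–892).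
* [ChattopadhyayDattaGhosalMukhopadhyay2022] A. Chattopadhyay, R. Datta, U. Ghosal,
  P. Mukhopadhyay, *Monotone complexity of spanning tree polynomial re-visited*, ITCS 2022, §3.
-/

noncomputable section

namespace Literature.Barriers.ValiantsHypothesis

open MvPolynomial Finset
open scoped NNReal Pointwise

variable {N : ℕ}

/-! ### The monomials of `ST` -/

section Monomials

/-- The exponent vector of the monomial `Π_i x_{i, t i}` of a parent map `t`.
[cite: JerrumSnir1982, §4.5] -/
def arbMonomial (t : Fin N → Option (Fin N)) : (Fin N × Option (Fin N)) →₀ ℕ :=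
  ∑ i : Fin N, Finsupp.single (i, t i) 1

/-- The exponent of `x_{i,j}` in the monomial of `t` is `1` if `t i = j` and `0` otherwise.
[cite: JerrumSnir1982, §4.5] -/
theorem arbMonomial_apply (t : Fin N → Option (Fin N)) (i : Fin N) (j : Option (Fin N)) :
    arbMonomial t (i, j) = if t i = j then 1 else 0 := by
  classical
  simp only [arbMonomial, Finsupp.coe_finsetSum, Finset.sum_apply, Finsupp.single_apply,
    Prod.mk.injEq]
  rw [Finset.sum_eq_single i]
  · simp
  · intro i' _ hi'
    rw [if_neg]
    exact fun h => hi' h.1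
  · simp

/-- Distinct parent maps have distinct monomials. [cite: JerrumSnir1982, §4.5] -/
theorem arbMonomial_injective : Function.Injective (arbMonomial (N := N)) := by
  intro t₁ t₂ h
  funext i
  have h1 : arbMonomial t₁ (i, t₁ i) = 1 := by rw [arbMonomial_apply, if_pos rfl]
  rw [h, arbMonomial_apply] at h1
  by_cases h2 : t₂ i = t₁ i
  · exact h2.symm
  · rw [if_neg h2] at h1; exact absurd h1 zero_ne_one

/-- `Π_i x_{i, t i}` is the monomial with exponent vector `arbMonomial t`. [folklore] -/
theorem prod_X_arb_eq_monomial (R : Type*) [CommSemiring R] (t : Fin N → Option (Fin N)) :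
    ∏ i : Fin N, (X (i, t i) : MvPolynomial (Fin N × Option (Fin N)) R) =
      monomial (arbMonomial t) 1 := by
  rw [arbMonomial, monomial_sum_one]
  rfl

open Classical in
/-- The finite set of arborescences (Jerrum–Snir's `T(n)`, `n = N + 1`). [cite: JerrumSnir1982, §4.5] -/
def arborescences (N : ℕ) : Finset (Fin N → Option (Fin N)) :=
  (Finset.univ : Finset (Fin N → Option (Fin N))).filter IsArborescence

/-- Membership in `arborescences`. [folklore] -/
@[simp] theorem mem_arborescences {t : Fin N → Option (Fin N)} :
    t ∈ arborescences N ↔ IsArborescence t := by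
  classical
  simp [arborescences]

/-- `ST = Σ_{t arborescence} monomial(t)`. [cite: JerrumSnir1982, §4.5] -/
theorem stPoly_eq_sum_monomial (R : Type*) [CommSemiring R] (N : ℕ) :
    stPoly R N = ∑ t ∈ arborescences N, monomial (arbMonomial t) 1 := by
  unfold stPoly arborescences
  exact Finset.sum_congr rfl fun t _ => prod_X_arb_eq_monomial R t

/-- The coefficients of `ST` are `1` on the monomials of arborescences and `0` elsewhere.
[cite: JerrumSnir1982, §4.5] -/
theorem coeff_stPoly (R : Type*) [CommSemiring R] (x : (Fin N × Option (Fin N)) →₀ ℕ) :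
    coeff x (stPoly R N) = if x ∈ (arborescences N).image arbMonomial then 1 else 0 := by
  classical
  rw [stPoly_eq_sum_monomial, coeff_sum]
  simp only [coeff_monomial]
  split_ifs with hx
  · obtain ⟨t, ht, rfl⟩ := mem_image.mp hx
    rw [Finset.sum_eq_single t]
    · simp
    · intro t' _ ht'
      rw [if_neg (fun h => ht' (arbMonomial_injective h))]
    · intro h; exact absurd ht h
  · refine Finset.sum_eq_zero fun t ht => if_neg fun h => hx ?_
    exact mem_image.mpr ⟨t, ht, h⟩

/-- **The support of `ST`** is the set of monomials of arborescences.
[cite: JerrumSnir1982, §4.5] -/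
theorem support_stPoly (R : Type*) [CommSemiring R] [Nontrivial R] (N : ℕ) :
    (stPoly R N).support = (arborescences N).image arbMonomial := by
  ext x
  rw [mem_support_iff, coeff_stPoly]
  split_ifs with hx <;> simp [hx]

/-- `|mon(ST)|` is the number of arborescences. [cite: JerrumSnir1982, §4.5] -/
theorem card_support_stPoly (R : Type*) [CommSemiring R] [Nontrivial R] (N : ℕ) :
    (stPoly R N).support.card = (arborescences N).card := by
  rw [support_stPoly, card_image_of_injective _ arbMonomial_injective]

/-- A parent map with a 2-cycle `i → j → i` is not an arborescence. [folklore] -/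
theorem not_isArborescence_of_two_cycle {t : Fin N → Option (Fin N)} {i j : Fin N}
    (hi : t i = some j) (hj : t j = some i) : ¬ IsArborescence t := by
  intro ht
  obtain ⟨r, hr⟩ := ht i
  have : ∀ r : ℕ, (parentMap t)^[r] (some i) = some i ∨ (parentMap t)^[r] (some i) = some j := by
    intro r
    induction r with
    | zero => exact Or.inl rfl
    | succ r ih =>
      rw [Function.iterate_succ_apply']
      rcases ih with h | h <;> rw [h] <;> simp [hi, hj]
  rcases this r with h | h <;> rw [h] at hr <;> exact Option.some_ne_none _ hr

end Monomials

/-! ### No cancellation over `ℝ≥0` -/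

section Positive

variable {σ : Type*}

/-- Over `ℝ≥0` products do not cancel: `mon(a) + mon(b) ⊆ mon(a · b)`.
[cite: JerrumSnir1982, §2.2 and Lemma 3.1] -/
theorem add_mem_support_mul {a b : MvPolynomial σ ℝ≥0} {x y : σ →₀ ℕ} (hx : x ∈ a.support)
    (hy : y ∈ b.support) : x + y ∈ (a * b).support := by
  classical
  rw [mem_support_iff, coeff_mul]
  intro h
  have hmem : (x, y) ∈ Finset.antidiagonal (x + y) := Finset.mem_antidiagonal.mpr rfl
  have hle := Finset.single_le_sum (s := Finset.antidiagonal (x + y))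
    (f := fun p : (σ →₀ ℕ) × (σ →₀ ℕ) => coeff p.1 a * coeff p.2 b) (fun p _ => zero_le) hmem
  simp only at hle
  rw [h, nonpos_iff_eq_zero, mul_eq_zero] at hle
  rcases hle with h1 | h2
  · exact mem_support_iff.mp hx h1
  · exact mem_support_iff.mp hy h2

end Positive

/-! ### Rows, columns, and the rectangle bound -/

section Rectangle

/-- The rows used by a monomial: `i` such that some `x_{i,j}` occurs. [cite: JerrumSnir1982, §4.5 (the index set `I_q`)] -/
def rows (x : (Fin N × Option (Fin N)) →₀ ℕ) : Finset (Fin N) :=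
  x.support.image Prod.fst

/-- Membership in `rows`. [folklore] -/
theorem mem_rows {x : (Fin N × Option (Fin N)) →₀ ℕ} {i : Fin N} :
    i ∈ rows x ↔ ∃ j, x (i, j) ≠ 0 := by
  simp only [rows, mem_image, Finsupp.mem_support_iff, Prod.exists, exists_and_right,
    exists_eq_right]

open Classical in
/-- The columns used by a polynomial in row `i`: the `j` with `x_{i,j}` occurring in some
monomial (Jerrum–Snir's `X_i`, per factor). [cite: JerrumSnir1982, §4.5 (the sets `X_i`)] -/
def cols (a : MvPolynomial (Fin N × Option (Fin N)) ℝ≥0) (i : Fin N) : Finset (Option (Fin N)) :=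
  Finset.univ.filter fun j => ∃ x ∈ a.support, x (i, j) ≠ 0

/-- Membership in `cols`. [folklore] -/
theorem mem_cols {a : MvPolynomial (Fin N × Option (Fin N)) ℝ≥0} {i : Fin N}
    {j : Option (Fin N)} : j ∈ cols a i ↔ ∃ x ∈ a.support, x (i, j) ≠ 0 := by
  classical
  simp [cols]

variable {x y : (Fin N × Option (Fin N)) →₀ ℕ} {t : Fin N → Option (Fin N)}

/-- If `x + y` is the monomial of `t` and `x_{i,j}` occurs in `x`, then `t i = j`, the exponent
is `1`, and `x_{i,j}` does not occur in `y`. [cite: JerrumSnir1982, §4.5] -/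
theorem apply_eq_of_add_eq (h : x + y = arbMonomial t) {i : Fin N} {j : Option (Fin N)}
    (hx : x (i, j) ≠ 0) : t i = j ∧ x (i, j) = 1 ∧ y (i, j) = 0 := by
  have := congr_arg (fun f => f (i, j)) h
  simp only [Finsupp.coe_add, Pi.add_apply, arbMonomial_apply] at this
  split_ifs at this with hti
  · exact ⟨hti, by omega, by omega⟩
  · omega

/-- The two summands of a tree monomial use complementary rows. [cite: JerrumSnir1982, §4.5 ("`{I_a, I_b, I_c}` is a partition")] -/
theorem rows_eq_compl (h : x + y = arbMonomial t) : rows x = (rows y)ᶜ := by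
  ext i
  simp only [mem_rows, mem_compl, not_exists, not_not]
  constructor
  · rintro ⟨j, hj⟩ j'
    by_contra hj'
    have h1 := apply_eq_of_add_eq h hj
    have h2 := apply_eq_of_add_eq (y := x) (by rwa [add_comm] at h) hj'
    have : j = j' := h1.1.symm.trans h2.1
    subst this
    exact hj h2.2.2
  · intro hy
    refine ⟨t i, ?_⟩
    have := congr_arg (fun f => f (i, t i)) h
    simp only [Finsupp.coe_add, Pi.add_apply, arbMonomial_apply, if_true] at this
    have hy' := hy (t i)
    omega

/-- A summand of a tree monomial has degree equal to its number of rows (one variable per row,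
exponent one). [cite: JerrumSnir1982, §4.5] -/
theorem degree_eq_card_rows (h : x + y = arbMonomial t) :
    (x.sum fun _ e => e) = (rows x).card := by
  unfold Finsupp.sum rows
  rw [card_image_of_injOn, Finset.card_eq_sum_ones]
  · refine Finset.sum_congr rfl fun p hp => ?_
    obtain ⟨i, j⟩ := p
    exact (apply_eq_of_add_eq h (Finsupp.mem_support_iff.mp hp)).2.1
  · rintro ⟨i, j⟩ hp ⟨i', j'⟩ hp' (hii' : i = i')
    subst hii'
    have h1 := (apply_eq_of_add_eq h (Finsupp.mem_support_iff.mp hp)).1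
    have h2 := (apply_eq_of_add_eq h (Finsupp.mem_support_iff.mp hp')).1
    rw [h1.symm.trans h2]

variable {a b : MvPolynomial (Fin N × Option (Fin N)) ℝ≥0}

/-- **One factor of a rectangle is small.** If every monomial `x` of `a` completes the fixed
monomial `y₀` to a tree monomial `x + y₀ = arbMonomial t`, then `a` has at most
`Π_{i ∉ rows y₀} |cols a i|` monomials (a monomial is determined by its parent map `t`, whose
values on the rows of `y₀` are forced by `y₀` and elsewhere lie in `cols a i`).
[cite: JerrumSnir1982, §4.5 ("bounded by the number of functions `t` which respect `x_{i,t(i)} ∈ X_i`")] -/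
theorem card_support_le_prod_card_cols {y₀ : (Fin N × Option (Fin N)) →₀ ℕ}
    (h : ∀ x ∈ a.support, ∃ t : Fin N → Option (Fin N), x + y₀ = arbMonomial t) :
    a.support.card ≤ ∏ i ∈ (rows y₀)ᶜ, (cols a i).card := by
  classical
  by_cases ha : a.support = ∅
  · simp [ha]
  obtain ⟨x₀, hx₀⟩ := Finset.nonempty_iff_ne_empty.mpr ha
  -- the parent map of a monomial
  let tOf : ((Fin N × Option (Fin N)) →₀ ℕ) → (Fin N → Option (Fin N)) := fun x =>
    if hx : ∃ t : Fin N → Option (Fin N), x + y₀ = arbMonomial t then Classical.choose hx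
    else fun _ => none
  have htOf : ∀ x ∈ a.support, x + y₀ = arbMonomial (tOf x) := by
    intro x hx
    simp only [tOf, dif_pos (h x hx)]
    exact Classical.choose_spec (h x hx)
  -- the box containing all parent maps
  let box : Fin N → Finset (Option (Fin N)) := fun i =>
    if i ∈ rows y₀ then {tOf x₀ i} else cols a i
  have hmaps : ∀ x ∈ a.support, tOf x ∈ Fintype.piFinset box := by
    intro x hx
    rw [Fintype.mem_piFinset]
    intro i
    by_cases hi : i ∈ rows y₀
    · simp only [box, hi, if_true, mem_singleton]
      obtain ⟨j, hj⟩ := mem_rows.mp hi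
      have h1 := (apply_eq_of_add_eq (y := x) (by rw [add_comm]; exact htOf x hx) hj).1
      have h2 := (apply_eq_of_add_eq (y := x₀) (by rw [add_comm]; exact htOf x₀ hx₀) hj).1
      rw [h1, h2]
    · simp only [box, hi, if_false, mem_cols]
      have hi' : i ∈ rows x := by rw [rows_eq_compl (htOf x hx)]; exact mem_compl.mpr hi
      obtain ⟨j, hj⟩ := mem_rows.mp hi'
      have h1 := (apply_eq_of_add_eq (htOf x hx) hj).1
      exact ⟨x, hx, by rw [h1]; exact hj⟩
  have hinj : Set.InjOn tOf a.support := by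
    intro x hx x' hx' heq
    have h1 := htOf x hx
    have h2 := htOf x' hx'
    rw [heq] at h1
    exact add_right_cancel (h1.trans h2.symm)
  calc a.support.card ≤ (Fintype.piFinset box).card :=
        Finset.card_le_card_of_injOn tOf hmaps hinj
    _ = ∏ i, (box i).card := Fintype.card_piFinset box
    _ = ∏ i ∈ (rows y₀)ᶜ, (cols a i).card := by
        rw [← Finset.prod_mul_prod_compl (rows y₀) (fun i => (box i).card)]
        rw [Finset.prod_eq_one (fun i hi => by simp [box, hi]), one_mul]
        exact Finset.prod_congr rfl fun i hi => by simp [box, (mem_compl.mp hi)]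

/-- The columns of `a` in row `i ∈ I` are the root, rows of `I`, or *crossing* columns `j ∉ I`:
`|cols a i| ≤ 1 + |I| + |{j ∉ I : x_{i,j} occurs in a}|`. [cite: JerrumSnir1982, §4.5] -/
theorem card_cols_le (a : MvPolynomial (Fin N × Option (Fin N)) ℝ≥0) (I : Finset (Fin N))
    (i : Fin N) :
    (cols a i).card ≤ 1 + I.card + (Iᶜ.filter fun j => some j ∈ cols a i).card := by
  classical
  have hsub : cols a i ⊆
      insert none ((I ∪ Iᶜ.filter fun j => some j ∈ cols a i).image some) := by
    intro j hj
    cases j with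
    | none => exact mem_insert_self _ _
    | some j =>
      refine mem_insert_of_mem (mem_image.mpr ⟨j, ?_, rfl⟩)
      by_cases hjI : j ∈ I
      · exact mem_union_left _ hjI
      · exact mem_union_right _ (mem_filter.mpr ⟨mem_compl.mpr hjI, hj⟩)
  calc (cols a i).card
      ≤ (insert none ((I ∪ Iᶜ.filter fun j => some j ∈ cols a i).image some)).card :=
        card_le_card hsub
    _ ≤ ((I ∪ Iᶜ.filter fun j => some j ∈ cols a i).image some).card + 1 := card_insert_le _ _
    _ ≤ (I ∪ Iᶜ.filter fun j => some j ∈ cols a i).card + 1 := by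
        gcongr; exact card_image_le
    _ ≤ I.card + (Iᶜ.filter fun j => some j ∈ cols a i).card + 1 := by
        gcongr; exact card_union_le _ _
    _ = 1 + I.card + (Iᶜ.filter fun j => some j ∈ cols a i).card := by ring

/-- **Two-cycle exclusion** ("`x_{i_a i_b}` and `x_{i_b i_a}` cannot both appear"): if
`mon(a) + mon(b)` consists of tree monomials, then for no pair `(i, j)` does `x_{i,j}` occur in
`a` and `x_{j,i}` in `b`. [cite: JerrumSnir1982, §4.5] -/
theorem not_mem_cols_of_mem_cols
    (hab : ∀ x ∈ a.support, ∀ y ∈ b.support, ∃ t, IsArborescence t ∧ x + y = arbMonomial t)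
    {i j : Fin N} (hi : some j ∈ cols a i) (hj : some i ∈ cols b j) : False := by
  obtain ⟨x, hx, hxi⟩ := mem_cols.mp hi
  obtain ⟨y, hy, hyj⟩ := mem_cols.mp hj
  obtain ⟨t, ht, hxy⟩ := hab x hx y hy
  have h1 := (apply_eq_of_add_eq hxy hxi).1
  have h2 := (apply_eq_of_add_eq (y := x) (by rwa [add_comm] at hxy) hyj).1
  exact not_isArborescence_of_two_cycle h1 h2 ht

/-- The sum of the crossing counts of `a` (over `i ∈ I`, columns `∉ I`) and of `b` (over
`j ∉ I`, columns `∈ I`) is at most `|I| · |Iᶜ|`, by two-cycle exclusion.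
[cite: JerrumSnir1982, §4.5 ("`Σ |X_i| ≤ (n-1)² - |I_a||I_b| - …`")] -/
theorem sum_crossing_le
    (hab : ∀ x ∈ a.support, ∀ y ∈ b.support, ∃ t, IsArborescence t ∧ x + y = arbMonomial t)
    (I : Finset (Fin N)) :
    ∑ i ∈ I, (Iᶜ.filter fun j => some j ∈ cols a i).card +
        ∑ j ∈ Iᶜ, (I.filter fun i => some i ∈ cols b j).card ≤ I.card * Iᶜ.card := by
  classical
  set E : Finset (Fin N × Fin N) := (I ×ˢ Iᶜ).filter fun p => some p.2 ∈ cols a p.1 with hE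
  set E' : Finset (Fin N × Fin N) := (I ×ˢ Iᶜ).filter fun p => some p.1 ∈ cols b p.2 with hE'
  have h1 : ∑ i ∈ I, (Iᶜ.filter fun j => some j ∈ cols a i).card = E.card := by
    rw [hE, card_filter, sum_product]
    refine sum_congr rfl fun i _ => ?_
    rw [card_filter]
  have h2 : ∑ j ∈ Iᶜ, (I.filter fun i => some i ∈ cols b j).card = E'.card := by
    rw [hE', card_filter, sum_product, sum_comm]
    refine sum_congr rfl fun j _ => ?_
    rw [card_filter]
  have hdisj : Disjoint E E' := by
    rw [Finset.disjoint_left]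
    rintro ⟨i, j⟩ hp hp'
    rw [hE, mem_filter] at hp
    rw [hE', mem_filter] at hp'
    exact not_mem_cols_of_mem_cols hab hp.2 hp'.2
  rw [h1, h2, ← card_union_of_disjoint hdisj, ← card_product]
  exact card_le_card (union_subset (filter_subset _ _) (filter_subset _ _))

/-- **AM–GM for a product of nonnegative reals**: `Π_{i ∈ s} z_i ≤ ((Σ_{i ∈ s} z_i)/|s|)^{|s|}`
("the product is maximized when `|X_i|` is independent of `i`"). [folklore] -/
theorem prod_le_arith_mean_pow {ι : Type*} (s : Finset ι) (hs : s.Nonempty) (z : ι → ℝ)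
    (hz : ∀ i ∈ s, 0 ≤ z i) : ∏ i ∈ s, z i ≤ ((∑ i ∈ s, z i) / s.card) ^ s.card := by
  have hn : (0 : ℝ) < s.card := by exact_mod_cast hs.card_pos
  have hw : ∑ i ∈ s, (fun _ => (s.card : ℝ)⁻¹) i = 1 := by
    rw [sum_const, nsmul_eq_mul, mul_inv_cancel₀ hn.ne']
  have h := Real.geom_mean_le_arith_mean_weighted s (fun _ => (s.card : ℝ)⁻¹) z
    (fun _ _ => by positivity) hw hz
  rw [← mul_sum] at h
  have hprod : 0 ≤ ∏ i ∈ s, z i ^ (s.card : ℝ)⁻¹ :=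
    prod_nonneg fun i hi => Real.rpow_nonneg (hz i hi) _
  have hpow := pow_le_pow_left₀ hprod h s.card
  rw [← prod_pow] at hpow
  have hlhs : ∏ i ∈ s, (z i ^ (s.card : ℝ)⁻¹) ^ s.card = ∏ i ∈ s, z i := by
    refine prod_congr rfl fun i hi => ?_
    rw [← Real.rpow_natCast, ← Real.rpow_mul (hz i hi), inv_mul_cancel₀ hn.ne', Real.rpow_one]
  rw [hlhs] at hpow
  calc ∏ i ∈ s, z i ≤ ((s.card : ℝ)⁻¹ * ∑ i ∈ s, z i) ^ s.card := hpow
    _ = ((∑ i ∈ s, z i) / s.card) ^ s.card := by rw [inv_mul_eq_div]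

/-- **Jerrum–Snir's content bound for `ST` (two factors).** If `a, b ≠ 0` over `ℝ≥0` and
`mon(a · b) ⊆ mon(ST_N)`, `N ≥ 1`, then with `k = deg a ≤ N`:
`|mon(a · b)| ≤ ((N + k² + (N - k)² + k (N - k)) / N) ^ N`.
[cite: JerrumSnir1982, §4.5 (pp. 891–892)] -/
theorem card_support_mul_le (hN : 1 ≤ N) (hab : (a * b).support ⊆ (stPoly ℝ≥0 N).support)
    (ha : a ≠ 0) (hb : b ≠ 0) :
    a.totalDegree ≤ N ∧
      ((a * b).support.card : ℝ) ≤
        (((N + a.totalDegree ^ 2 + (N - a.totalDegree) ^ 2 +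
            a.totalDegree * (N - a.totalDegree) : ℕ) : ℝ) / N) ^ N := by
  classical
  -- every pair of monomials glues to a tree monomial
  have hpair : ∀ x ∈ a.support, ∀ y ∈ b.support,
      ∃ t, IsArborescence t ∧ x + y = arbMonomial t := by
    intro x hx y hy
    have := hab (add_mem_support_mul hx hy)
    rw [support_stPoly, mem_image] at this
    obtain ⟨t, ht, hxy⟩ := this
    exact ⟨t, mem_arborescences.mp ht, hxy.symm⟩
  obtain ⟨x₀, hx₀⟩ := support_nonempty.mpr ha
  obtain ⟨y₀, hy₀⟩ := support_nonempty.mpr hb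
  set I : Finset (Fin N) := rows x₀ with hI
  -- all monomials of `a` have rows `I`, all monomials of `b` have rows `Iᶜ`
  have hrowb : ∀ y ∈ b.support, rows y = Iᶜ := by
    intro y hy
    obtain ⟨t, -, h⟩ := hpair x₀ hx₀ y hy
    rw [hI, rows_eq_compl h, compl_compl]
  have hrowa : ∀ x ∈ a.support, rows x = I := by
    intro x hx
    obtain ⟨t, -, h⟩ := hpair x hx y₀ hy₀
    rw [rows_eq_compl h, hrowb y₀ hy₀, compl_compl]
  -- the degree of `a` is `|I|`
  have hdeg : a.totalDegree = I.card := by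
    apply le_antisymm
    · apply Finset.sup_le
      intro x hx
      obtain ⟨t, -, h⟩ := hpair x hx y₀ hy₀
      rw [degree_eq_card_rows h, hrowa x hx]
    · obtain ⟨t, -, h⟩ := hpair x₀ hx₀ y₀ hy₀
      have := Finset.le_sup (f := fun s : (Fin N × Option (Fin N)) →₀ ℕ => s.sum fun _ e => e) hx₀
      simp only [degree_eq_card_rows h] at this
      exact this
  have hkN : I.card ≤ N := by simpa using card_le_univ I
  refine ⟨hdeg ▸ hkN, ?_⟩
  -- the two boxes
  have hA : a.support.card ≤ ∏ i ∈ I, (cols a i).card := by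
    have := card_support_le_prod_card_cols (a := a) (y₀ := y₀)
      (fun x hx => by obtain ⟨t, -, h⟩ := hpair x hx y₀ hy₀; exact ⟨t, h⟩)
    rwa [hrowb y₀ hy₀, compl_compl] at this
  have hB : b.support.card ≤ ∏ j ∈ Iᶜ, (cols b j).card := by
    have := card_support_le_prod_card_cols (a := b) (y₀ := x₀)
      (fun y hy => by
        obtain ⟨t, -, h⟩ := hpair x₀ hx₀ y hy
        exact ⟨t, by rw [add_comm]; exact h⟩)
    rwa [← hI] at this
  -- combine: `|mon(ab)| ≤ |mon a| |mon b| ≤ Π_i z_i`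
  let z : Fin N → ℕ := fun i => if i ∈ I then (cols a i).card else (cols b i).card
  have hprodz : (a * b).support.card ≤ ∏ i, z i := by
    calc (a * b).support.card ≤ (a.support + b.support).card := card_le_card (support_mul a b)
      _ ≤ a.support.card * b.support.card := card_add_le
      _ ≤ (∏ i ∈ I, (cols a i).card) * ∏ j ∈ Iᶜ, (cols b j).card :=
          Nat.mul_le_mul hA hB
      _ = ∏ i, z i := by
          rw [← Finset.prod_mul_prod_compl I z]
          congr 1
          · exact prod_congr rfl fun i hi => by simp [z, hi]
          · exact prod_congr rfl fun i hi => by simp [z, mem_compl.mp hi]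
  -- the sum of the `z_i`
  have hsumz : ∑ i, z i ≤ N + I.card ^ 2 + (N - I.card) ^ 2 + I.card * (N - I.card) := by
    have hIc : Iᶜ.card = N - I.card := by rw [card_compl, Fintype.card_fin]
    have hsplit : ∑ i, z i = ∑ i ∈ I, (cols a i).card + ∑ j ∈ Iᶜ, (cols b j).card := by
      rw [← Finset.sum_add_sum_compl I z]
      congr 1
      · exact sum_congr rfl fun i hi => by simp [z, hi]
      · exact sum_congr rfl fun i hi => by simp [z, mem_compl.mp hi]
    have ha' : ∑ i ∈ I, (cols a i).card ≤
        ∑ i ∈ I, (1 + I.card + (Iᶜ.filter fun j => some j ∈ cols a i).card) :=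
      sum_le_sum fun i _ => card_cols_le a I i
    have hb' : ∑ j ∈ Iᶜ, (cols b j).card ≤
        ∑ j ∈ Iᶜ, (1 + Iᶜ.card + (Iᶜᶜ.filter fun i => some i ∈ cols b j).card) :=
      sum_le_sum fun j _ => card_cols_le b Iᶜ j
    rw [compl_compl] at hb'
    rw [sum_add_distrib, sum_const, smul_eq_mul] at ha' hb'
    have hcross := sum_crossing_le hpair I
    rw [hsplit]
    calc ∑ i ∈ I, (cols a i).card + ∑ j ∈ Iᶜ, (cols b j).card
        ≤ (I.card * (1 + I.card) + ∑ i ∈ I, (Iᶜ.filter fun j => some j ∈ cols a i).card) +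
          (Iᶜ.card * (1 + Iᶜ.card) + ∑ j ∈ Iᶜ, (I.filter fun i => some i ∈ cols b j).card) :=
          Nat.add_le_add ha' hb'
      _ ≤ I.card * (1 + I.card) + Iᶜ.card * (1 + Iᶜ.card) + I.card * Iᶜ.card := by omega
      _ = N + I.card ^ 2 + (N - I.card) ^ 2 + I.card * (N - I.card) := by
          rw [hIc]
          generalize hu : N - I.card = u
          have hN' : N = I.card + u := by omega
          linarith [hN']
  -- AM–GM
  have hN0 : (Finset.univ : Finset (Fin N)).Nonempty :=
    Finset.univ_nonempty_iff.mpr ⟨⟨0, by omega⟩⟩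
  have hamgm := prod_le_arith_mean_pow (Finset.univ : Finset (Fin N)) hN0 (fun i => (z i : ℝ))
    (fun i _ => by positivity)
  rw [card_univ, Fintype.card_fin] at hamgm
  rw [hdeg]
  calc ((a * b).support.card : ℝ) ≤ ((∏ i, z i : ℕ) : ℝ) := by exact_mod_cast hprodz
    _ = ∏ i, (z i : ℝ) := by push_cast; rfl
    _ ≤ ((∑ i, (z i : ℝ)) / N) ^ N := hamgm
    _ ≤ (((N + I.card ^ 2 + (N - I.card) ^ 2 + I.card * (N - I.card) : ℕ) : ℝ) / N) ^ N := by
        have hcast : (∑ i, (z i : ℝ)) ≤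
            ((N + I.card ^ 2 + (N - I.card) ^ 2 + I.card * (N - I.card) : ℕ) : ℝ) := by
          exact_mod_cast hsumz
        have h0 : (0 : ℝ) ≤ (∑ i, (z i : ℝ)) / N :=
          div_nonneg (Finset.sum_nonneg fun i _ => Nat.cast_nonneg _) (Nat.cast_nonneg _)
        apply pow_le_pow_left₀ h0
        exact div_le_div_of_nonneg_right hcast (Nat.cast_nonneg _)

end Rectangle

end Literature.Barriers.ValiantsHypothesis
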